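import Mathlib.Analysis.Calculus.Deriv.Slope
import Mathlib.MeasureTheory.Constructions.BorelSpace.Metrizable
import Literature.Analysis.PDE.BurgersHopfLax
import HarnessLib

/-!
# The Lax–Hopf formula for Burgers' equation, II: the Hopf–Lax potential

Continuation of `Literature/Analysis/PDE/BurgersHopfLax.lean` (definitions `burgersPrimitive`,
`laxFunction`, `laxMinimizer = y₊`, `hopfSolution = u`, `hopfLaxPotential = W`). Everything here
is proved:

* `y₊(t,·)` and `u(t,·)` are continuous from the right (Hörmander Lemma 2.4.1, (2.4.7)″);
  periodic data give `y₊(t,x+p) = y₊(t,x) + p` and a `p`-periodic `u(t,·)`.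
* one-sided comparison inequalities for `W` obtained by testing the Lax function at `y₊`:
  `W(t,x') - W(t,x) ≤ (x'-x) u(t,x) + (x'-x)²/2t`, `W(s,x) - W(t,x) ≤ u(t,x)² t(t-s)/2s`;
* `W(t,·)` is `M`-Lipschitz, `W(·,x)` is nonincreasing and `M²/2`-Lipschitz (scaling
  `y ↦ x + (t/t')(y-x)`), `W` is jointly continuous;
* `(W(t,x+h) - W(t,x))/h → u(t,x)` as `h → 0+` for EVERY `t > 0`, `x` (so `u = ∂ₓ⁺W`), whence
  `u` is jointly Borel measurable; and `∂ₜW(t,x) = -u(t,x)²/2` at every point of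
  differentiability of `W(·,x)` — the Hamilton–Jacobi equation `Wₜ + Wₓ²/2 = 0` of
  Evans §3.4.2 / Dafermos (11.4.11).

## References

* L. Hörmander, *Lectures on Nonlinear Hyperbolic Differential Equations* (1997), §2.4,
  Lemma 2.4.1, Thm 2.4.2. [Hormander1997]
* L. C. Evans, *Partial Differential Equations*, 2nd ed. (2010), §3.4.2. [Evans2010]
* C. M. Dafermos, *Hyperbolic Conservation Laws in Continuum Physics*, 2nd ed. (2005), §11.4,
  (11.4.10), (11.4.11). [Dafermos2005]
-/

noncomputable section

open Set Filter MeasureTheory intervalIntegral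
open scoped Topology

namespace Literature.Analysis.PDE

variable {u₀ : ℝ → ℝ} {M : ℝ}

/-! ### Right continuity in `x` -/

/-- **`y₊(t,·)` is continuous from the right** (Hörmander Lemma 2.4.1): the right limit of the
monotone function `y₊(t,·)` at `x` is again a minimizer of `F(t,x,·)`.
[cite: Hormander1997, Lemma 2.4.1] -/
theorem continuousWithinAt_laxMinimizer_Ioi (hm : Measurable u₀) (hM : ∀ x, |u₀ x| ≤ M) {t : ℝ}
    (ht : 0 < t) (x : ℝ) : ContinuousWithinAt (laxMinimizer u₀ t) (Ioi x) x := by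
  have hmono := laxMinimizer_monotone hm hM ht
  have hgeL : laxMinimizer u₀ t x ≤ sInf (laxMinimizer u₀ t '' Ioi x) :=
    le_csInf (nonempty_Ioi.image _) (by
      rintro _ ⟨x', hx', rfl⟩
      exact hmono (le_of_lt hx'))
  have hL : Tendsto (laxMinimizer u₀ t) (𝓝[>] x) (𝓝 (sInf (laxMinimizer u₀ t '' Ioi x))) :=
    hmono.tendsto_nhdsGT x
  generalize sInf (laxMinimizer u₀ t '' Ioi x) = L at hgeL hL
  have hc := continuous_laxFunction_uncurry hm hM t
  have hid : Tendsto (fun x' : ℝ => x') (𝓝[>] x) (𝓝 x) := tendsto_id.mono_left nhdsWithin_le_nhds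
  -- the right limit `L` is a minimizer at `x`
  have hLmem : L ∈ laxArgmin u₀ t x := by
    intro z
    have hp1 : Tendsto (fun x' => (x', laxMinimizer u₀ t x')) (𝓝[>] x) (𝓝 (x, L)) :=
      hid.prodMk_nhds hL
    have hp2 : Tendsto (fun x' => (x', z)) (𝓝[>] x) (𝓝 (x, z)) :=
      hid.prodMk_nhds tendsto_const_nhds
    have h1 := (hc.tendsto (x, L)).comp hp1
    have h2 := (hc.tendsto (x, z)).comp hp2
    exact le_of_tendsto_of_tendsto' h1 h2 fun x' => laxFunction_laxMinimizer_le hm hM ht x' z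
  have hLle : L ≤ laxMinimizer u₀ t x := le_laxMinimizer hm hM ht hLmem
  obtain rfl : L = laxMinimizer u₀ t x := le_antisymm hLle hgeL
  exact hL

/-- Hopf's solution `u(t,·)` is continuous from the right (`u = u(t, x+0)`, Hörmander (2.4.7)″).
[cite: Hormander1997, Thm 2.4.2 (2.4.7)″] -/
theorem continuousWithinAt_hopfSolution_Ioi (hm : Measurable u₀) (hM : ∀ x, |u₀ x| ≤ M) {t : ℝ}
    (ht : 0 < t) (x : ℝ) : ContinuousWithinAt (hopfSolution u₀ t) (Ioi x) x := by
  have h := continuousWithinAt_laxMinimizer_Ioi hm hM ht x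
  have heq : hopfSolution u₀ t = fun x => (x - laxMinimizer u₀ t x) / t := by
    funext x
    exact hopfSolution_of_pos u₀ ht x
  rw [heq]
  exact (continuousWithinAt_id.sub h).div_const t

/-! ### Periodic data -/

/-- For `p`-periodic data, `U₀(y + p) = U₀(y) + ∫₀ᵖ u₀`. [folklore] -/
theorem burgersPrimitive_add_period (hm : Measurable u₀) (hM : ∀ x, |u₀ x| ≤ M) {p : ℝ}
    (hp : Function.Periodic u₀ p) (y : ℝ) :
    burgersPrimitive u₀ (y + p) = burgersPrimitive u₀ y + ∫ z in (0 : ℝ)..p, u₀ z := by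
  have h := burgersPrimitive_sub hm hM y (y + p)
  rw [hp.intervalIntegral_add_eq y 0, zero_add] at h
  linarith

/-- For `p`-periodic data, `F(t, x + p, y + p) = F(t,x,y) + ∫₀ᵖ u₀`. [folklore] -/
theorem laxFunction_add_period (hm : Measurable u₀) (hM : ∀ x, |u₀ x| ≤ M) {p : ℝ}
    (hp : Function.Periodic u₀ p) (t x y : ℝ) :
    laxFunction u₀ t (x + p) (y + p) = laxFunction u₀ t x y + ∫ z in (0 : ℝ)..p, u₀ z := by
  simp only [laxFunction, burgersPrimitive_add_period hm hM hp]
  ring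

/-- For `p`-periodic data the minimizer sets translate: `y + p ∈ argmin F(t,x+p,·)` iff
`y ∈ argmin F(t,x,·)`. [folklore] -/
theorem add_mem_laxArgmin_iff (hm : Measurable u₀) (hM : ∀ x, |u₀ x| ≤ M) {p : ℝ}
    (hp : Function.Periodic u₀ p) (t x y : ℝ) :
    y + p ∈ laxArgmin u₀ t (x + p) ↔ y ∈ laxArgmin u₀ t x := by
  constructor
  · intro h z
    have h' := h (z + p)
    rw [laxFunction_add_period hm hM hp, laxFunction_add_period hm hM hp] at h'
    linarith
  · intro h z
    obtain ⟨w, rfl⟩ : ∃ w, z = w + p := ⟨z - p, by ring⟩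
    rw [laxFunction_add_period hm hM hp, laxFunction_add_period hm hM hp]
    linarith [h w]

/-- For `p`-periodic data, `y₊(t, x + p) = y₊(t,x) + p`. [folklore] -/
theorem laxMinimizer_add_period (hm : Measurable u₀) (hM : ∀ x, |u₀ x| ≤ M) {p : ℝ}
    (hp : Function.Periodic u₀ p) {t : ℝ} (ht : 0 < t) (x : ℝ) :
    laxMinimizer u₀ t (x + p) = laxMinimizer u₀ t x + p := by
  apply le_antisymm
  · have hmem : laxMinimizer u₀ t (x + p) - p ∈ laxArgmin u₀ t x := by
      rw [← add_mem_laxArgmin_iff hm hM hp, sub_add_cancel]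
      exact laxMinimizer_mem hm hM ht (x + p)
    linarith [le_laxMinimizer hm hM ht hmem]
  · have hmem : laxMinimizer u₀ t x + p ∈ laxArgmin u₀ t (x + p) :=
      (add_mem_laxArgmin_iff hm hM hp t x _).2 (laxMinimizer_mem hm hM ht x)
    exact le_laxMinimizer hm hM ht hmem

/-- **Periodic data give a periodic Hopf solution**: `u(t, x + p) = u(t, x)`. [folklore] -/
theorem hopfSolution_periodic (hm : Measurable u₀) (hM : ∀ x, |u₀ x| ≤ M) {p : ℝ}
    (hp : Function.Periodic u₀ p) (t : ℝ) : Function.Periodic (hopfSolution u₀ t) p := by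
  intro x
  by_cases ht : 0 < t
  · rw [hopfSolution_of_pos u₀ ht, hopfSolution_of_pos u₀ ht, laxMinimizer_add_period hm hM hp ht]
    ring
  · rw [hopfSolution_of_nonpos u₀ (not_lt.1 ht), hopfSolution_of_nonpos u₀ (not_lt.1 ht)]


/-! ### Lipschitz bounds on the Hopf–Lax potential -/

/-- One-sided comparison in `x` at fixed `t > 0`:
`W(t,x') - W(t,x) ≤ (x' - x) u(t,x) + (x' - x)²/(2t)` (test `F(t,x',·)` at `y₊(t,x)`).
[folklore] -/
theorem hopfLaxPotential_sub_le_x (hm : Measurable u₀) (hM : ∀ x, |u₀ x| ≤ M) {t : ℝ}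
    (ht : 0 < t) (x x' : ℝ) :
    hopfLaxPotential u₀ t x' - hopfLaxPotential u₀ t x
      ≤ (x' - x) * hopfSolution u₀ t x + (x' - x) ^ 2 / (2 * t) := by
  have h := hopfLaxPotential_le_laxFunction hm hM ht x' (laxMinimizer u₀ t x)
  rw [hopfLaxPotential_of_pos u₀ ht x, hopfSolution_of_pos u₀ ht]
  unfold laxFunction at h ⊢
  have e : (x' - laxMinimizer u₀ t x) ^ 2 / (2 * t) - (x - laxMinimizer u₀ t x) ^ 2 / (2 * t)
      = (x' - x) * ((x - laxMinimizer u₀ t x) / t) + (x' - x) ^ 2 / (2 * t) := by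
    field_simp
    ring
  linarith

/-- One-sided comparison in `t` at fixed `x`: for `s, t > 0`,
`W(s,x) - W(t,x) ≤ u(t,x)² · t (t - s)/(2s)` (test `F(s,x,·)` at `y₊(t,x)`). [folklore] -/
theorem hopfLaxPotential_sub_le_t (hm : Measurable u₀) (hM : ∀ x, |u₀ x| ≤ M) {s t : ℝ}
    (hs : 0 < s) (ht : 0 < t) (x : ℝ) :
    hopfLaxPotential u₀ s x - hopfLaxPotential u₀ t x
      ≤ hopfSolution u₀ t x ^ 2 * (t * (t - s) / (2 * s)) := by
  have h := hopfLaxPotential_le_laxFunction hm hM hs x (laxMinimizer u₀ t x)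
  rw [hopfLaxPotential_of_pos u₀ ht x, hopfSolution_of_pos u₀ ht]
  unfold laxFunction at h ⊢
  have e : (x - laxMinimizer u₀ t x) ^ 2 / (2 * s) - (x - laxMinimizer u₀ t x) ^ 2 / (2 * t)
      = ((x - laxMinimizer u₀ t x) / t) ^ 2 * (t * (t - s) / (2 * s)) := by
    field_simp
  linarith

/-- **`W(t,·)` is `M`-Lipschitz** (an infimum of `M`-Lipschitz functions of `x`). [folklore] -/
theorem abs_hopfLaxPotential_sub_le_x (hm : Measurable u₀) (hM : ∀ x, |u₀ x| ≤ M) (t x x' : ℝ) :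
    |hopfLaxPotential u₀ t x' - hopfLaxPotential u₀ t x| ≤ M * |x' - x| := by
  by_cases ht : 0 < t
  · -- test `F(t,x',·)` at `y₊(t,x) + (x' - x)` and symmetrically
    have key : ∀ a b : ℝ, hopfLaxPotential u₀ t b - hopfLaxPotential u₀ t a ≤ M * |b - a| := by
      intro a b
      have h := hopfLaxPotential_le_laxFunction hm hM ht b (laxMinimizer u₀ t a + (b - a))
      rw [hopfLaxPotential_of_pos u₀ ht a]
      unfold laxFunction at h ⊢
      have hU := abs_burgersPrimitive_sub_le hm hM (laxMinimizer u₀ t a)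
        (laxMinimizer u₀ t a + (b - a))
      rw [show laxMinimizer u₀ t a + (b - a) - laxMinimizer u₀ t a = b - a by ring] at hU
      have hU' := (le_abs_self _).trans hU
      have e : (b - (laxMinimizer u₀ t a + (b - a))) ^ 2 = (a - laxMinimizer u₀ t a) ^ 2 := by
        ring
      rw [e] at h
      linarith
    rw [abs_le]
    constructor
    · have := key x' x
      rw [abs_sub_comm] at this
      linarith
    · exact key x x'
  · rw [hopfLaxPotential_of_nonpos u₀ (not_lt.1 ht), hopfLaxPotential_of_nonpos u₀ (not_lt.1 ht)]
    exact abs_burgersPrimitive_sub_le hm hM x x'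

/-- **`W(·,x)` is nonincreasing**: `W(t',x) ≤ W(t,x)` for `t ≤ t'`. [folklore] -/
theorem hopfLaxPotential_antitone (hm : Measurable u₀) (hM : ∀ x, |u₀ x| ≤ M) (x : ℝ) :
    Antitone fun t => hopfLaxPotential u₀ t x := by
  intro t t' htt'
  dsimp only
  by_cases ht : 0 < t
  · have ht' : 0 < t' := ht.trans_le htt'
    have h := hopfLaxPotential_le_laxFunction hm hM ht' x (laxMinimizer u₀ t x)
    rw [hopfLaxPotential_of_pos u₀ ht x]
    unfold laxFunction at h ⊢
    have : (x - laxMinimizer u₀ t x) ^ 2 / (2 * t') ≤ (x - laxMinimizer u₀ t x) ^ 2 / (2 * t) :=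
      div_le_div_of_nonneg_left (sq_nonneg _) (by positivity) (by linarith)
    linarith
  · rw [hopfLaxPotential_of_nonpos u₀ (not_lt.1 ht)]
    exact hopfLaxPotential_le_burgersPrimitive hm hM t' x

/-- **Scaling bound in `t`**: `W(t,x) - W(t',x) ≤ M²(t' - t)/2` for `0 < t ≤ t'`
(substitute `y ↦ x + (t/t')(y - x)` in the infimum). [folklore] -/
theorem hopfLaxPotential_sub_le_of_pos (hm : Measurable u₀) (hM : ∀ x, |u₀ x| ≤ M) {t t' : ℝ}
    (ht : 0 < t) (htt' : t ≤ t') (x : ℝ) :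
    hopfLaxPotential u₀ t x - hopfLaxPotential u₀ t' x ≤ M ^ 2 * (t' - t) / 2 := by
  have ht' : 0 < t' := ht.trans_le htt'
  set y' := laxMinimizer u₀ t' x with hy'
  -- test `F(t,x,·)` at `ỹ = x + (t/t')(y' - x)`
  have h := hopfLaxPotential_le_laxFunction hm hM ht x (x + t / t' * (y' - x))
  rw [hopfLaxPotential_of_pos u₀ ht' x, ← hy']
  unfold laxFunction at h ⊢
  have hU := abs_burgersPrimitive_sub_le hm hM y' (x + t / t' * (y' - x))
  have hU' := (le_abs_self _).trans hU
  have hlam : 0 ≤ 1 - t / t' := by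
    rw [sub_nonneg, div_le_one ht']
    exact htt'
  have e1 : |x + t / t' * (y' - x) - y'| = (1 - t / t') * |x - y'| := by
    rw [show x + t / t' * (y' - x) - y' = (1 - t / t') * (x - y') by ring, abs_mul,
      abs_of_nonneg hlam]
  rw [e1] at hU'
  have e2 : (x - (x + t / t' * (y' - x))) ^ 2 / (2 * t) - (x - y') ^ 2 / (2 * t')
      = -((1 - t / t') * ((x - y') ^ 2 / (2 * t'))) := by
    field_simp
    ring
  -- `M r - r²/(2t') ≤ M² t'/2`
  have hquad : M * |x - y'| - (x - y') ^ 2 / (2 * t') ≤ M ^ 2 * t' / 2 := by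
    have hsq : M ^ 2 * t' / 2 - (M * |x - y'| - (x - y') ^ 2 / (2 * t'))
        = (|x - y'| - M * t') ^ 2 / (2 * t') := by
      field_simp
      rw [← sq_abs (x - y')]
      ring
    have : 0 ≤ (|x - y'| - M * t') ^ 2 / (2 * t') := by positivity
    linarith
  have hmul := mul_le_mul_of_nonneg_left hquad hlam
  have e3 : (1 - t / t') * (M ^ 2 * t' / 2) = M ^ 2 * (t' - t) / 2 := by
    field_simp
  nlinarith [hmul, e2, e3, hU', h]

/-- **`W(·,x)` is `M²/2`-Lipschitz on `ℝ`** (with the extension by `U₀` for `t ≤ 0`).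
[folklore] -/
theorem abs_hopfLaxPotential_sub_le_t (hm : Measurable u₀) (hM : ∀ x, |u₀ x| ≤ M) (t t' x : ℝ) :
    |hopfLaxPotential u₀ t x - hopfLaxPotential u₀ t' x| ≤ M ^ 2 / 2 * |t - t'| := by
  -- reduce to `t ≤ t'`
  wlog htt' : t ≤ t' generalizing t t'
  · have h := this t' t (le_of_not_ge htt')
    rwa [abs_sub_comm, abs_sub_comm t' t] at h
  have hanti := hopfLaxPotential_antitone hm hM x htt'
  dsimp only at hanti
  rw [abs_of_nonneg (sub_nonneg.2 hanti), abs_of_nonpos (sub_nonpos.2 htt')]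
  by_cases ht : 0 < t
  · have h := hopfLaxPotential_sub_le_of_pos hm hM ht htt' x
    linarith
  · push Not at ht
    rw [hopfLaxPotential_of_nonpos u₀ ht]
    by_cases ht' : 0 < t'
    · have h := burgersPrimitive_sub_le_hopfLaxPotential hm hM ht'.le x
      have hM2 : 0 ≤ M ^ 2 / 2 * (-t) := mul_nonneg (by positivity) (by linarith)
      nlinarith
    · push Not at ht'
      rw [hopfLaxPotential_of_nonpos u₀ ht', sub_self]
      have : 0 ≤ M ^ 2 / 2 * -(t - t') := mul_nonneg (by positivity) (by linarith)
      linarith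

/-- `W(t,·)` is Lipschitz. [folklore] -/
theorem lipschitzWith_hopfLaxPotential_x (hm : Measurable u₀) (hM : ∀ x, |u₀ x| ≤ M) (t : ℝ) :
    LipschitzWith (Real.toNNReal M) fun x => hopfLaxPotential u₀ t x :=
  LipschitzWith.of_dist_le_mul fun a b => by
    rw [Real.dist_eq, Real.dist_eq, Real.coe_toNNReal _ (nonneg_of_abs_le hM)]
    exact abs_hopfLaxPotential_sub_le_x hm hM t b a

/-- `W(·,x)` is Lipschitz. [folklore] -/
theorem lipschitzWith_hopfLaxPotential_t (hm : Measurable u₀) (hM : ∀ x, |u₀ x| ≤ M) (x : ℝ) :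
    LipschitzWith (Real.toNNReal (M ^ 2 / 2)) fun t => hopfLaxPotential u₀ t x :=
  LipschitzWith.of_dist_le_mul fun a b => by
    rw [Real.dist_eq, Real.dist_eq, Real.coe_toNNReal _ (by positivity)]
    exact abs_hopfLaxPotential_sub_le_t hm hM a b x

/-- **The potential is jointly Lipschitz, hence continuous, on `ℝ × ℝ`.** [folklore] -/
theorem continuous_uncurry_hopfLaxPotential (hm : Measurable u₀) (hM : ∀ x, |u₀ x| ≤ M) :
    Continuous (Function.uncurry (hopfLaxPotential u₀)) := by
  have hM0 := nonneg_of_abs_le hM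
  refine (LipschitzWith.of_dist_le_mul (K := Real.toNNReal (M ^ 2 / 2 + M)) fun p q => ?_).continuous
  rw [Real.dist_eq, Function.uncurry, Function.uncurry, Real.coe_toNNReal _ (by positivity)]
  have h1 := abs_hopfLaxPotential_sub_le_t hm hM p.1 q.1 p.2
  have h2 := abs_hopfLaxPotential_sub_le_x hm hM q.1 q.2 p.2
  have hd1 : |p.1 - q.1| ≤ dist p q := by
    rw [← Real.dist_eq, Prod.dist_eq]
    exact le_max_left _ _
  have hd2 : |p.2 - q.2| ≤ dist p q := by
    rw [← Real.dist_eq, Prod.dist_eq]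
    exact le_max_right _ _
  have htri : |hopfLaxPotential u₀ p.1 p.2 - hopfLaxPotential u₀ q.1 q.2|
      ≤ |hopfLaxPotential u₀ p.1 p.2 - hopfLaxPotential u₀ q.1 p.2|
        + |hopfLaxPotential u₀ q.1 p.2 - hopfLaxPotential u₀ q.1 q.2| := abs_sub_le _ _ _
  have hM2 : 0 ≤ M ^ 2 / 2 := by positivity
  nlinarith [mul_le_mul_of_nonneg_left hd1 hM2, mul_le_mul_of_nonneg_left hd2 hM0]

/-! ### Difference quotients: `∂ₓW = u` from the right everywhere, `∂ₜW = -u²/2` where it exists -/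

/-- **Right difference quotients of `W(t,·)` converge to Hopf's solution**:
`(W(t,x+h) - W(t,x))/h → u(t,x)` as `h → 0+`, for every `t > 0` and `x` (squeeze between
`u(t,x+h) - h/2t` and `u(t,x) + h/2t`, right continuity of `u(t,·)`). [folklore] -/
theorem tendsto_slope_hopfLaxPotential_x (hm : Measurable u₀) (hM : ∀ x, |u₀ x| ≤ M) {t : ℝ}
    (ht : 0 < t) (x : ℝ) :
    Tendsto (fun h => (hopfLaxPotential u₀ t (x + h) - hopfLaxPotential u₀ t x) / h)
      (𝓝[>] 0) (𝓝 (hopfSolution u₀ t x)) := by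
  -- lower and upper bounds
  have hup : ∀ h : ℝ, 0 < h → (hopfLaxPotential u₀ t (x + h) - hopfLaxPotential u₀ t x) / h
      ≤ hopfSolution u₀ t x + h / (2 * t) := by
    intro h hh
    rw [div_le_iff₀ hh]
    have := hopfLaxPotential_sub_le_x hm hM ht x (x + h)
    rw [show x + h - x = h by ring] at this
    have e : (hopfSolution u₀ t x + h / (2 * t)) * h = h * hopfSolution u₀ t x + h ^ 2 / (2 * t) := by
      ring
    linarith
  have hlow : ∀ h : ℝ, 0 < h → hopfSolution u₀ t (x + h) - h / (2 * t)
      ≤ (hopfLaxPotential u₀ t (x + h) - hopfLaxPotential u₀ t x) / h := by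
    intro h hh
    rw [le_div_iff₀ hh]
    have := hopfLaxPotential_sub_le_x hm hM ht (x + h) x
    rw [show x - (x + h) = -h by ring] at this
    have e : (hopfSolution u₀ t (x + h) - h / (2 * t)) * h
        = -(-h * hopfSolution u₀ t (x + h) + (-h) ^ 2 / (2 * t)) := by
      ring
    linarith
  -- limits of the bounds
  have h0 : Tendsto (fun h : ℝ => h / (2 * t)) (𝓝[>] 0) (𝓝 0) := by
    have : Tendsto (fun h : ℝ => h / (2 * t)) (𝓝 0) (𝓝 (0 / (2 * t))) :=
      tendsto_id.div_const _
    rw [zero_div] at this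
    exact this.mono_left nhdsWithin_le_nhds
  have hshift : Tendsto (fun h : ℝ => x + h) (𝓝[>] 0) (𝓝[>] x) := by
    refine tendsto_nhdsWithin_iff.2 ⟨?_, ?_⟩
    · have : Tendsto (fun h : ℝ => x + h) (𝓝 0) (𝓝 (x + 0)) := tendsto_const_nhds.add tendsto_id
      rw [add_zero] at this
      exact this.mono_left nhdsWithin_le_nhds
    · filter_upwards [self_mem_nhdsWithin] with h hh
      simpa using hh
  have hu : Tendsto (fun h : ℝ => hopfSolution u₀ t (x + h)) (𝓝[>] 0) (𝓝 (hopfSolution u₀ t x)) :=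
    (continuousWithinAt_hopfSolution_Ioi hm hM ht x).tendsto.comp hshift
  have hlow' : Tendsto (fun h : ℝ => hopfSolution u₀ t (x + h) - h / (2 * t)) (𝓝[>] 0)
      (𝓝 (hopfSolution u₀ t x)) := by simpa using hu.sub h0
  have hup' : Tendsto (fun h : ℝ => hopfSolution u₀ t x + h / (2 * t)) (𝓝[>] 0)
      (𝓝 (hopfSolution u₀ t x)) := by simpa using tendsto_const_nhds.add h0
  refine tendsto_of_tendsto_of_tendsto_of_le_of_le' hlow' hup' ?_ ?_
  · filter_upwards [self_mem_nhdsWithin] with h hh using hlow h hh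
  · filter_upwards [self_mem_nhdsWithin] with h hh using hup h hh

/-- The sequence `1/(n+1)` tends to `0` from the right. [folklore] -/
theorem tendsto_one_div_add_one_nhdsGT :
    Tendsto (fun n : ℕ => 1 / ((n : ℝ) + 1)) atTop (𝓝[>] 0) :=
  tendsto_nhdsWithin_iff.2
    ⟨tendsto_one_div_add_atTop_nhds_zero_nat,
      Eventually.of_forall fun n => mem_Ioi.2 (by positivity)⟩

/-- **Hopf's solution is jointly Borel measurable**: it is the pointwise limit of the continuous
difference quotients `(W(t,x+1/(n+1)) - W(t,x))(n+1)` on `t > 0` (and `0` on `t ≤ 0`).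
[folklore] -/
theorem measurable_uncurry_hopfSolution (hm : Measurable u₀) (hM : ∀ x, |u₀ x| ≤ M) :
    Measurable (Function.uncurry (hopfSolution u₀)) := by
  have hW := continuous_uncurry_hopfLaxPotential hm hM
  let v : ℕ → ℝ × ℝ → ℝ := fun n p => if 0 < p.1 then
    (hopfLaxPotential u₀ p.1 (p.2 + 1 / ((n : ℝ) + 1)) - hopfLaxPotential u₀ p.1 p.2)
      / (1 / ((n : ℝ) + 1)) else 0
  have hv : ∀ n, Measurable (v n) := by
    intro n
    refine Measurable.ite (measurableSet_lt measurable_const measurable_fst) ?_ measurable_const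
    have h1 : Continuous fun p : ℝ × ℝ => hopfLaxPotential u₀ p.1 (p.2 + 1 / ((n : ℝ) + 1)) :=
      hW.comp (continuous_fst.prodMk (continuous_snd.add continuous_const))
    exact ((h1.sub hW).div_const _).measurable
  refine measurable_of_tendsto_metrizable hv (tendsto_pi_nhds.2 fun p => ?_)
  by_cases hp : 0 < p.1
  · simp only [v, if_pos hp, Function.uncurry]
    exact (tendsto_slope_hopfLaxPotential_x hm hM hp p.2).comp tendsto_one_div_add_one_nhdsGT
  · simp only [v, if_neg hp, Function.uncurry, hopfSolution_of_nonpos u₀ (not_lt.1 hp)]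
    exact tendsto_const_nhds

/-- Hopf's solution at fixed time is Borel measurable. [folklore] -/
theorem measurable_hopfSolution (hm : Measurable u₀) (hM : ∀ x, |u₀ x| ≤ M) (t : ℝ) :
    Measurable (hopfSolution u₀ t) :=
  (measurable_uncurry_hopfSolution hm hM).comp (measurable_const.prodMk measurable_id)

/-- **`∂ₜW = -u²/2` wherever `W(·,x)` is differentiable** (`t > 0`): the one-sided difference
quotients are squeezed by `-u(t,x)² t/(2s)` as `s → t±` (test `F(s,x,·)` at `y₊(t,x)`). This is
the Hamilton–Jacobi equation `∂ₜW + (∂ₓW)²/2 = 0` of Evans §3.4.2 / Dafermos (11.4.11) at points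
of differentiability. [cite: Evans2010, §3.4.2 Thm 1] -/
theorem hasDerivAt_hopfLaxPotential_t_unique (hm : Measurable u₀) (hM : ∀ x, |u₀ x| ≤ M)
    {t : ℝ} (ht : 0 < t) {x D : ℝ} (hD : HasDerivAt (fun s => hopfLaxPotential u₀ s x) D t) :
    D = -(hopfSolution u₀ t x ^ 2 / 2) := by
  set c := hopfSolution u₀ t x with hc
  rw [hasDerivAt_iff_tendsto_slope] at hD
  -- the comparison function `s ↦ -c² t/(2s)` tends to `-c²/2`
  have hb : Tendsto (fun s : ℝ => -(c ^ 2 * t / (2 * s))) (𝓝 t) (𝓝 (-(c ^ 2 / 2))) := by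
    have : Tendsto (fun s : ℝ => -(c ^ 2 * t / (2 * s))) (𝓝 t) (𝓝 (-(c ^ 2 * t / (2 * t)))) := by
      refine ((tendsto_const_nhds.div (tendsto_const_nhds.mul tendsto_id) ?_).neg)
      positivity
    rwa [show c ^ 2 * t / (2 * t) = c ^ 2 / 2 by field_simp] at this
  -- `W(s,x) - W(t,x) ≤ -c²t/(2s) · (s - t)` for every `s > 0`
  have key : ∀ s : ℝ, 0 < s → hopfLaxPotential u₀ s x - hopfLaxPotential u₀ t x
      ≤ -(c ^ 2 * t / (2 * s)) * (s - t) := by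
    intro s hs
    have h := hopfLaxPotential_sub_le_t hm hM hs ht x
    rw [← hc] at h
    have e : -(c ^ 2 * t / (2 * s)) * (s - t) = c ^ 2 * (t * (t - s) / (2 * s)) := by ring
    linarith
  apply le_antisymm
  · have hD' := hD.mono_left (nhdsWithin_mono t (show Ioi t ⊆ {t}ᶜ from fun s hs => ne_of_gt hs))
    refine le_of_tendsto_of_tendsto hD' (hb.mono_left nhdsWithin_le_nhds) ?_
    filter_upwards [self_mem_nhdsWithin] with s hs
    rw [slope_def_field, div_le_iff₀ (sub_pos.2 hs)]
    exact key s (ht.trans hs)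
  · have hD' := hD.mono_left (nhdsWithin_mono t (show Iio t ⊆ {t}ᶜ from fun s hs => ne_of_lt hs))
    refine le_of_tendsto_of_tendsto (hb.mono_left nhdsWithin_le_nhds) hD' ?_
    filter_upwards [Ioo_mem_nhdsLT ht] with s hs
    rw [slope_def_field, le_div_iff_of_neg (sub_neg.2 hs.2)]
    exact key s hs.1

end Literature.Analysis.PDE
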